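import Summits.BirchSwinnertonDyer.BirchSwinnertonDyer.Theorems.ClassRecordThreeKolyGlue
import Summits.BirchSwinnertonDyer.Rank1Residual.X11b.Three.TamagawaAdditiveThree
import Literature.NumberTheory.EllipticCurves.HeegnerPointsOfConductorOneData
import Literature.NumberTheory.EllipticCurves.KolyvaginShaStructureDivisibility

/-!
# Route `ClassRecordThree` (rung K2@3), crux 5 `EulerHalvesAtThree` (item 19109, shared by
# `KolyvaginRoadThree`): the Euler-system half on the Tamagawa atom at `3 ∥ N` REDUCED to the JETCHEV
# DIRECTION of the refined Kolyvagin conjecture (`M_∞ ≥ t`) through McCallum's structure theorem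
# (cell `bsd-stepL`, seat `bsd-stepL-tam3-p1`; `--supports stmt-BirchSwinnertonDyer-19109`)

Item 19109 asks for the Euler-system (upper) half `Typed.MissingUpperBoundAt W 3`
(`ord₃ #Ш(E/ℚ) ≤ ord₃ #Ш(E/ℚ)_an`) of `(E, 3) ∈` X11b (`r_an = 1`, `3 ∥ N`, `E[3]` irreducible) on three
loci: (α) a (ram) witness and the Tamagawa shape `ShapeAlpha` (`3` split, `3 ∣ c₃`); (γ∖α) a (ram)
witness, split at `3`, `ShapeGamma` (an additive IV/IV* place with `c = 3`); (0) `ρ̄_{E,3}` onto and NO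
(ram) witness. On the first two Kolyvagin's bound `ord₃ #Ш(E/K) ≤ 2·ord₃ [E(K):ℤy_K]` over the
Hoffstein–Luo Heegner field loses exactly the Tamagawa term `2t`, `t = ord₃ ∏_ℓ c_ℓ(E)`, of BSD over `K`
(the tree's `JetchevShapeOverK.lean` §2); on the third the descent to `ℚ` loses the rank-`0` `3`-part of
the twist `E^{d_K}`, whose printed source (Skinner 2016 Thm. C) needs (ram).

WHAT THE TWO FILES PROVE (this is file 1/2: §1–§2; kernel bookkeeping over landed tree theorems; nothing
new is asserted, every open input is an explicit, labelled binder):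

* §1 `shaIndexBound_sharp_three_of_globalDivisibility` — AT ONE FRAME: McCallum's Cor. 5.6 in its
  UPPER form (the Literature fact `McCallum1991_padicValNat_card_sha_primary_add_le_of_globalDivisibility`,
  `hMcU`: "`M_∞ ≥ t ⇒ ord_p #Ш(E/K)[p^∞] + 2t ≤ 2M₀`") turns GLOBAL `3^s`-DIVISIBILITY of all derived
  Heegner points `P_n` (`n ∈ S_r(s)`, `s ≤ t`; koly's `Koly.PDiv`) on a conductor-`1` frame into the
  Tamagawa-SHARPENED Kolyvagin bound over `K`, `ord₃ #Ш(E/K) + 2t ≤ 2·ord₃ [E(K):ℤP]` — literally the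
  binder `hU`/`hJet` of x11b3's `sharp_of_heegnerData_of_odd` ∕
  `missingUpperBoundAt_of_classX11b_of_ram_of_jetchevShape_odd` (there labelled "OPEN, no source at
  `p ∣ N`"), now DERIVED from a statement about Heegner points alone plus a published structure theorem.
* §2 `missingUpperBoundAt_three_of_classX11b_of_ram_of_jetchevDivisibility` — CLASS LEVEL, (ram): for
  every `(E,3) ∈` X11b with a (ram) witness — ALL Tamagawa shapes at once (α, β, γ, any number of
  carriers, and A1) — `Typed.MissingUpperBoundAt W 3` from the published named facts (Gross–Zagier,
  Kolyvagin, Skinner 2016 Thm. C for the twist, GZK, modularity, newforms, Hoffstein–Luo, Mazur's Manin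
  bound, Shimura reciprocity at conductor `1`, Darmon's Thm. 3.6, McCallum's Cor. 5.6 upper form) and ONE
  open input **J₃ʳ** (`hJ`): the JETCHEV DIRECTION at `3 ∥ N` — on every Manin-good conductor-`1` frame
  `(Dt, β, ι)` of a curve multiplicative at `3` with `ρ̄_{E,3}` onto and a (ram) witness, over an
  imaginary quadratic Heegner `K` with `d_K ≠ −3`, every derived point `P_n` (`n` a square-free product
  of Kolyvagin primes of index `≥ s`, `n = 1` allowed) is `3^s`-divisible in `E(K_n)` for every
  `s ≤ t = ord₃ ∏_ℓ c_ℓ(E)`; i.e. `M_∞ ≥ t` (Jetchev 2008 Conj. 1.3's `≥`-half = his Thm. 1.4 with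
  `max` replaced by the sum; BCGS 2023 Thm. 2 shape; NOT in print at `p ∣ N`). J₃ʳ is the typed TWIN of
  koly's Z₃-tam (`M_∞ ≤ t`, HOME `koly/ZhangAtThreeTamagawaStandalone.lean`, MEMO-v6 §3): together they
  say `M_∞ = t`, and BOTH halves of `BSD₃(E/K)` on the Tamagawa atom then run through McCallum.
  Corollaries `stub_eulerAlphaAtThree_of_jetchevDivisibility` ∕ `stub_eulerGammaAtThree_of_jetchevDivisibility`:
  the registered stubs' signatures VERBATIM, modulo the binders.
* §3 (file 2/2, `ClassRecordThreeEulerHalvesAtThreeJetchevNotRam.lean`)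
  `missingUpperBoundAt_three_of_classX11b_of_surj_of_not_ram_of_jetchevDivisibility_of_twistLower` —
  CLASS LEVEL, ¬(ram) ∧ surj: the same over-`K` mechanism (binder **J₃⁰**: the Jetchev direction on
  ¬(ram) ∧ surj frames) descended to `ℚ` with the rank-`0` `3`-part LOWER bound for the twist supplied by
  the binder **TL₃** = the conclusion of Skinner 2016 Thm. C at a multiplicative `3` with `E[3]`
  irreducible WITHOUT its hypothesis (ii) (a ramified multiplicative prime) — on (ram) curves TL₃ IS
  `hSk`; its content is the (ram)-removal at `3` (cf. BCS 2025 at good `p ≥ 5`). Corollary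
  `stub_eulerSurjAtThree_of_…`: the third registered stub's signature verbatim, modulo the binders.
* §4 (file 2/2) `classRecordThree_eulerHalvesAtThree_of_jetchevDivisibility_of_twistLower` — the crux
  `Theses.ClassRecordThree.EulerHalvesAtThree` BY NAME from the published facts and EXACTLY the three open
  inputs {J₃ʳ, J₃⁰, TL₃}. So item 19109 = (J₃ on surj frames) + (TL₃ on ¬ram twists) modulo print.

HONEST FRAMING. Nothing here proves J₃ʳ, J₃⁰ or TL₃; they are hypothesis-shaped binders (no `def`, no
named fact), exactly as `hZ`/`hKD` were in `ClassRecordThreeKolyGlue.lean` before koly typed Z₃♯. The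
item does NOT close; the rung leaf is untouched; BSD is not advanced by bookkeeping. What the file buys: the
(T2′)@3 atom's missing upper half (567 TRUE-OPEN classes, all carriers) and A1's are ONE statement about
`3`-divisibility of Heegner points (finitely falsifiable per pair: one derived point `P_n`, `n ∈ S_r(s)`,
`s ≤ t`, not `3^s`-divisible refutes J₃ at that pair and — with McCallum — refutes `BSD₃(E/K)`), and the
¬(ram) upper half is that plus a named rank-`0` input. CONDITIONAL on every binder listed in each theorem.

References: [McCallumLMS1991] §5 Lemma 5.1, Thm. 5.4, Cor. 5.6 (pp. 303–310); [Jetchev2008] Conj. 1.3,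
Thm. 1.4, Cor. 1.5 (Compos. Math. 144 (2008) p. 812), Prop. 4.9, Lemma 4.3; [GrossLMS1991] Prop. 6.2,
§4 (4.1); [BurungaleEtAl2026] Thm. 2 (refined Kolyvagin conjecture, shape); [Skinner2016PacificMC]
Thm. C and footnote 1; [JetchevSkinnerWan2017] §7.4.2; [Darmon2004] Thm. 3.6; [Miller2011LMS] Def. 1.1;
cell files `X11b/Three/{KolyvaginLine, KolyvaginLineCertificate, JetchevShapeOverK, TamagawaAdditiveThree}.lean`,
`Theorems/ClassRecordThreeKolyGlue.lean` (p410690), HOME `koly/MEMO-v6.md` §1 LEMMA V (the two halves).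
-/

noncomputable section

open scoped Classical

namespace Summit.BirchSwinnertonDyer.Rank1Residual.X11b.Three.Koly

open WeierstrassCurve Literature.NumberTheory.EllipticCurves
  Literature.NumberTheory.EllipticCurves.ModularForms
  Literature.NumberTheory.EllipticCurves.Rank1Residual
  Summit.BirchSwinnertonDyer.Rank1Residual Summit.BirchSwinnertonDyer.Rank1Residual.X11b

/-! ### §1 At one frame: global divisibility + McCallum's upper form ⇒ the sharpened bound over `K` -/

/-- **The Tamagawa-sharpened Kolyvagin bound over `K` from global divisibility (one frame).** For `W/ℚ`
globally minimal, multiplicative at `3` with `ρ̄_{E,3}` onto (so `ρ_{E,3^m}` onto for all `m`, Tate line;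
non-CM), `K` imaginary quadratic Heegner for `N_E` with `d_K ∉ {−3, −4}`, a conductor-`1` Kolyvagin–Heegner
datum `d₁` on the frame `(Dt, β, ι)` whose derived point is `P ∈ E(K)` in `E(K̄)`, `P` of infinite order,
`E(K)` of rank one without `3`-torsion, `Ш(E/K)` finite: IF every derived point `P_n` on the frame with
`n` a square-free product of Kolyvagin primes of index `≥ s` is `3^s`-divisible in `E(K_n)` for all
`s ≤ t` (`hglob`, i.e. `M_∞ ≥ t`) and McCallum's Cor. 5.6 upper form holds (`hMcU`), THEN
`ord₃ #Ш(E/K) + 2t ≤ 2·ord₃ [E(K):ℤP]`. Proof: `3^{M₀} ∥ P` (Mordell–Weil), the fact gives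
`ord₃ #Ш[3^∞] + 2t ≤ 2M₀`, and `ord₃ #Ш = ord₃ #Ш[3^∞]`, `ord₃ [E(K):ℤP] = M₀` (McCallum Lemma 5.1;
tree `padicValNat_index_zmultiples_eq_of_divisibility`). CONDITIONAL on `hMcU` and `hglob`.
[cite: McCallumLMS1991, §5 Cor. 5.6 (p. 310) and Lemma 5.1 (p. 303)] [cite: Jetchev2008, §1 (1) and Conj. 1.3 (p. 812)] -/
theorem shaIndexBound_sharp_three_of_globalDivisibility
    (hMcU : McCallum1991_padicValNat_card_sha_primary_add_le_of_globalDivisibility)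
    (W : WeierstrassCurve ℚ) [W.IsElliptic] [W.IsGloballyMinimal] [NeZero (W.conductorNorm ℤ)]
    (K : Type) [Field K] [NumberField K]
    (hmult : W.HasMultiplicativeReductionAtPrime 3) (hρ : Surj W 3)
    (hK : IsImaginaryQuadratic K) (h3 : NumberField.discr K ≠ -3) (h4 : NumberField.discr K ≠ -4)
    (hHN : SatisfiesHeegnerHypothesis (W.conductorNorm ℤ) K)
    (Dt : ModularParametrizationData W (W.conductorNorm ℤ)) (β : ℤ) (ι : K →+* ℂ)
    (d₁ : KolyvaginHeegnerData Dt β ι 1) (P : (W.baseChange K).toAffine.Point)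
    (hPd : d₁.toGeomPoints d₁.derivedPoint = toGeomPoints (W.baseChange K) P)
    (hPinf : ¬ IsOfFinAddOrder P)
    (hrank : (W.baseChange K).mordellWeilRank = 1)
    (hiv : ∀ x : (W.baseChange K).toAffine.Point, 3 • x = 0 → x = 0)
    [Finite (W.baseChange K).sha] {t : ℕ}
    (hglob : ∀ (s : ℕ), s ≤ t → ∀ (n : ℕ) (d : KolyvaginHeegnerData Dt β ι n), Squarefree n →
      (∀ ℓ ∈ n.primeFactors, Zhang2014.IsKolyvaginPrime (W.conductorNorm ℤ) W K 3 ℓ ∧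
        s ≤ Zhang2014.kolyvaginIndex W 3 ℓ) → PDiv d 3 s) :
    padicValNat 3 (Nat.card (W.baseChange K).sha) + 2 * t ≤
      2 * padicValNat 3 (AddSubgroup.zmultiples P).index := by
  haveI : Fact (Nat.Prime 3) := ⟨Nat.prime_three⟩
  -- tower surjectivity at a multiplicative 3 (Tate line) and no CM
  have hsurj : ∀ m : ℕ, W.HasSurjectiveModNGaloisRep (3 ^ m : ℕ) :=
    Rank1Residual.surjective_pow_three_of_mult_of_tateLine W hmult hρ
  have hCM : ¬ W.HasCM := not_hasCM_of_hasMultiplicativeReductionAtPrime' W hmult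
  -- the exponent 3^{M₀} ∥ P (Mordell–Weil)
  haveI : Module.Finite ℤ (W.baseChange K).toAffine.Point := (W.baseChange K).module_finite_point_holds
  obtain ⟨M₀, x₀, hx₀, hmax⟩ := exists_pow_smul_eq_and_forall_ne hPinf (p := 3) (by norm_num)
  have hdiv : ∃ Q : (W.baseChange K).toAffine.Point, ((3 ^ M₀ : ℕ) : ℤ) • Q = P :=
    ⟨x₀, by rw [natCast_zsmul]; exact hx₀⟩
  have hndiv : ¬ ∃ Q : (W.baseChange K).toAffine.Point, ((3 ^ (M₀ + 1) : ℕ) : ℤ) • Q = P := by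
    rintro ⟨Q, hQ⟩
    exact hmax Q (by rw [← natCast_zsmul]; exact hQ)
  -- McCallum's Cor. 5.6, upper form
  have hle : padicValNat 3 (Nat.card (AddCommGroup.primaryComponent (W.baseChange K).sha 3)) + 2 * t ≤
      2 * M₀ :=
    hMcU W hCM K hK h3 h4 hHN 3 (by norm_num) hsurj Dt β ι d₁ P hPd hPinf M₀ hdiv hndiv t
      (fun s hs n d hn hℓ ↦ hglob s hs n d hn hℓ)
  -- `ord₃ #Ш = ord₃ #Ш[3^∞]` and `ord₃ [E(K):ℤP] = M₀`
  have hsha : padicValNat 3 (Nat.card (AddCommGroup.primaryComponent (W.baseChange K).sha 3)) =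
      padicValNat 3 (Nat.card (W.baseChange K).sha) :=
    padicValNat_card_addPrimaryComponent (A := (W.baseChange K).sha) 3
  haveI : Finite (AddCommGroup.torsion (W.baseChange K).toAffine.Point) :=
    WeierstrassCurve.finite_torsion_point (W := W.baseChange K)
  obtain ⟨c, Q, hcQ, hcker⟩ := RankOne.exists_coord_of_mordellWeilRank_eq_one (W.baseChange K) hrank
  have hidx : padicValNat 3 (AddSubgroup.zmultiples P).index = M₀ :=
    padicValNat_index_zmultiples_eq_of_divisibility c Q hcQ hcker hiv P hdiv hndiv
  rw [hidx, ← hsha]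
  exact hle

/-! ### §2 Class level, (ram): the upper half on ALL of X11b ∧ (ram) from the Jetchev direction J₃ʳ -/

/-- **The Euler-system half of `BSD(E,3)` on X11b ∧ (ram) — every Tamagawa shape — from the JETCHEV
DIRECTION at `3 ∥ N`.** For every `(E,3)` in class X11b (`r_an = 1`, `3 ∥ N` multiplicative — split or
non-split —, `E[3]` irreducible) with a (ram) witness: `Typed.MissingUpperBoundAt W 3`
(`ord₃ #Ш(E/ℚ) ≤ ord₃ #Ш(E/ℚ)_an`). Inputs: the PUBLISHED named facts Gross–Zagier (`hGZ`), Kolyvagin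
(`hKo`), Skinner 2016 Thm. C (`hSk`, for the twist, (ram) inherited), GZK (`hGZK`), modularity (`hmod`,
`hnf`), Hoffstein–Luo (`hHL`), Mazur's Manin bound (`hMaz`), Shimura reciprocity at conductor `1`
(`hrec`), Darmon 2004 Thm. 3.6 (`hD36`, the conductor-`1` datum exists), McCallum 1991 Cor. 5.6 upper
form (`hMcU`); and ONE OPEN input, the binder `hJ` = **J₃ʳ** (the Jetchev direction `M_∞ ≥ t` at every
Manin-good conductor-`1` frame of a multiplicative-at-`3`, surjective, (ram) curve; NOT in print at
`p ∣ N`; hypothesis shape — nothing asserted). Proof: the odd Hoffstein–Luo Heegner datum of the pair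
(`exists_oddHeegnerData`), a conductor-`1` datum on its frame (Darmon) with bottom point `y_K`
(Shimura reciprocity), rank one ∕ `Ш` finite (Kolyvagin), no `3`-torsion (irreducibility), §1 with
`t = ord₃ ∏c_ℓ(E)`, then x11b3's `missingUpperBoundAt_of_sharpIndexBound_of_le` (GZ bookkeeping, twist
transports, Skinner Thm. C, descent to `ℚ`). CONDITIONAL on every binder; nothing booked.
[cite: McCallumLMS1991, §5 Cor. 5.6 (p. 310)] [cite: Jetchev2008, Conj. 1.3, Thm. 1.4, Cor. 1.5 (p. 812)]
[cite: JetchevSkinnerWan2017, §7.4.2 (p. 31)] [cite: Skinner2016PacificMC, Thm. C (§1) and footnote 1]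
[cite: Darmon2004, Thm. 3.6 (PDF p. 43)] [cite: GrossLMS1991, §4 (4.1)] [cite: Miller2011LMS, Def. 1.1] -/
theorem missingUpperBoundAt_three_of_classX11b_of_ram_of_jetchevDivisibility
    -- published named facts
    (hGZ : ∀ (N : ℕ) [NeZero N] (W : WeierstrassCurve ℚ) (K : Type) [Field K] [NumberField K],
      gross_zagier N W K)
    (hKo : ∀ (N : ℕ) [NeZero N] (W : WeierstrassCurve ℚ) (K : Type) [Field K] [NumberField K],
      kolyvagin N W K)
    (hSk : Skinner2016.thmC_padicValRat_bsd_rank_zero)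
    (hGZK : rank_eq_analyticRank_of_analyticRank_le_one) (hmod : hasEntireLFunction_rat)
    (hnf : exists_isNewformOf) (hHL : HoffsteinLuo1997_exists_twist_L_one_ne_zero)
    (hMaz : mazur_not_dvd_maninConstant_of_odd)
    (hrec : ∀ (N : ℕ) [NeZero N] (W : WeierstrassCurve ℚ) (K : Type) [Field K] [NumberField K],
      heegnerPointOfConductor_one_galoisConj N W K)
    (hD36 : ∀ (N : ℕ) [NeZero N] (W : WeierstrassCurve ℚ) (K : Type) [Field K] [NumberField K],
      phi_heegnerTau_mem_singularModuliField N W K)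
    (hMcU : McCallum1991_padicValNat_card_sha_primary_add_le_of_globalDivisibility)
    -- OPEN INPUT J₃ʳ: the Jetchev direction at 3 ∥ N on (ram) ∧ surj frames (hypothesis shape)
    (hJ : ∀ (W : WeierstrassCurve ℚ) [W.IsElliptic] [W.IsGloballyMinimal] [NeZero (W.conductorNorm ℤ)]
      (K : Type) [Field K] [NumberField K]
      (Dt : ModularParametrizationData W (W.conductorNorm ℤ)) (β : ℤ) (ι : K →+* ℂ),
      W.HasMultiplicativeReductionAtPrime 3 → Surj W 3 → Ram W 3 →
      IsImaginaryQuadratic K → SatisfiesHeegnerHypothesis (W.conductorNorm ℤ) K →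
      NumberField.discr K ≠ -3 →
      (4 * (W.conductorNorm ℤ : ℤ)) ∣ β ^ 2 - NumberField.discr K → ¬ (3 : ℤ) ∣ Dt.c →
      ∀ (s : ℕ), s ≤ padicValNat 3 W.tamagawaProduct →
        ∀ (n : ℕ) (d : KolyvaginHeegnerData Dt β ι n), Squarefree n →
          (∀ ℓ ∈ n.primeFactors, Zhang2014.IsKolyvaginPrime (W.conductorNorm ℤ) W K 3 ℓ ∧
            s ≤ Zhang2014.kolyvaginIndex W 3 ℓ) → PDiv d 3 s)
    -- the pair
    (W : WeierstrassCurve ℚ) [W.IsElliptic] [W.IsGloballyMinimal]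
    (hX : ClassX11b W 3) (hram : Ram W 3) : Typed.MissingUpperBoundAt W 3 := by
  haveI : NeZero (W.conductorNorm ℤ) := ⟨(W.conductorNorm_pos_holds).ne'⟩
  obtain ⟨hr, h32, hmult, hirr⟩ := hX
  have hρ : Surj W 3 := surj_of_irr_of_ram W 3 hirr hram
  -- ONE odd Heegner datum with a Manin-good frame (Hoffstein–Luo field; Mazur; w_K = 2)
  obtain ⟨K, _, _, Dt, H, ι, P, Wd, _, _, Cd, hK, hodd, h3d, hHN, hP, hc, hμ, hLt, hWd⟩ :=
    exists_oddHeegnerData hnf hHL hMaz integral_neronScaling_of_isGloballyMinimal_holds W 3 hr h32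
      hmult hirr
  have h3 : NumberField.discr K ≠ -3 := by
    intro h
    exact h3d (h ▸ ⟨-1, by norm_num⟩)
  have h4 : NumberField.discr K ≠ -4 := by
    intro h
    rw [h] at hodd
    exact (Int.not_odd_iff_even.mpr ⟨-2, by norm_num⟩) hodd
  -- a conductor-1 Kolyvagin–Heegner datum on the frame (Dt, H.β, ι) (Darmon 2004, Thm. 3.6)
  obtain ⟨d₁⟩ := exists_kolyvaginHeegnerData_one (hD36 _ W K) hK Dt H.β ι H.dvd_sq_sub
  -- the bottom point: P(1) = y_K = P in E(K̄) (Shimura reciprocity at conductor 1)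
  have hPd : d₁.toGeomPoints d₁.derivedPoint = toGeomPoints (W.baseChange K) P :=
    KolyvaginBottom.toGeomPoints_derivedPoint_one_eq (hrec _ W K) hK hHN hP d₁ rfl
  -- the sharpened bound over K at this datum, from J₃ʳ + McCallum (§1)
  have hU : Finite (W.baseChange K).sha → ¬ IsOfFinAddOrder P →
      padicValNat 3 (Nat.card (W.baseChange K).sha) + 2 * padicValNat 3 W.tamagawaProduct ≤
        2 * padicValNat 3 (AddSubgroup.zmultiples P).index := by
    intro hfin hPinf
    haveI : Finite (W.baseChange K).sha := hfin
    -- rank one (Kolyvagin) and no 3-torsion (E[3] irreducible, K imaginary quadratic)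
    obtain ⟨hrank, -⟩ := hKo (W.conductorNorm ℤ) W K hK hHN ⟨Dt, H, ι, hP⟩ hPinf
    have hbot := torsionBy_eq_bot_of_isImaginaryQuadratic_of_hasIrreducibleModPGaloisRep W K hK
      Nat.prime_three hirr
    have hiv : ∀ x : (W.baseChange K).toAffine.Point, 3 • x = 0 → x = 0 := fun x hx ↦ by
      have hmem : x ∈ AddSubgroup.torsionBy (W.baseChange K).toAffine.Point ((3 : ℕ) : ℤ) := by
        rw [mem_torsionBy_iff, natCast_zsmul]
        exact hx
      rw [hbot] at hmem
      exact hmem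
    exact shaIndexBound_sharp_three_of_globalDivisibility hMcU W K hmult hρ hK h3 h4 hHN Dt H.β ι d₁ P
      hPd hPinf hrank hiv (hJ W K Dt H.β ι hmult hρ hram hK hHN h3 H.dvd_sq_sub hc)
  -- descent to ℚ: GZ bookkeeping, twist transports, Skinner Thm. C for E^{d_K} (x11b3)
  exact missingUpperBoundAt_of_sharpIndexBound_of_le W 3 K Dt H ι P (hGZ _ W K) (hKo _ W K) hSk hGZK
    hmod hr h32 hmult hirr hram hK hodd h3d hHN hP hc hμ hLt Wd Cd hWd (padicValNat 3 W.tamagawaProduct)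
    le_rfl hU

/-- **Registered stub `stub_eulerAlphaAtThree` (item 19109, shape α), modulo the binders of
`missingUpperBoundAt_three_of_classX11b_of_ram_of_jetchevDivisibility`** — its signature verbatim; the
shape hypothesis is not used (the (ram) theorem covers every Tamagawa shape). CONDITIONAL. [folklore] -/
theorem stub_eulerAlphaAtThree_of_jetchevDivisibility
    (hGZ : ∀ (N : ℕ) [NeZero N] (W : WeierstrassCurve ℚ) (K : Type) [Field K] [NumberField K],
      gross_zagier N W K)
    (hKo : ∀ (N : ℕ) [NeZero N] (W : WeierstrassCurve ℚ) (K : Type) [Field K] [NumberField K],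
      kolyvagin N W K)
    (hSk : Skinner2016.thmC_padicValRat_bsd_rank_zero)
    (hGZK : rank_eq_analyticRank_of_analyticRank_le_one) (hmod : hasEntireLFunction_rat)
    (hnf : exists_isNewformOf) (hHL : HoffsteinLuo1997_exists_twist_L_one_ne_zero)
    (hMaz : mazur_not_dvd_maninConstant_of_odd)
    (hrec : ∀ (N : ℕ) [NeZero N] (W : WeierstrassCurve ℚ) (K : Type) [Field K] [NumberField K],
      heegnerPointOfConductor_one_galoisConj N W K)
    (hD36 : ∀ (N : ℕ) [NeZero N] (W : WeierstrassCurve ℚ) (K : Type) [Field K] [NumberField K],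
      phi_heegnerTau_mem_singularModuliField N W K)
    (hMcU : McCallum1991_padicValNat_card_sha_primary_add_le_of_globalDivisibility)
    (hJ : ∀ (W : WeierstrassCurve ℚ) [W.IsElliptic] [W.IsGloballyMinimal] [NeZero (W.conductorNorm ℤ)]
      (K : Type) [Field K] [NumberField K]
      (Dt : ModularParametrizationData W (W.conductorNorm ℤ)) (β : ℤ) (ι : K →+* ℂ),
      W.HasMultiplicativeReductionAtPrime 3 → Surj W 3 → Ram W 3 →
      IsImaginaryQuadratic K → SatisfiesHeegnerHypothesis (W.conductorNorm ℤ) K →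
      NumberField.discr K ≠ -3 →
      (4 * (W.conductorNorm ℤ : ℤ)) ∣ β ^ 2 - NumberField.discr K → ¬ (3 : ℤ) ∣ Dt.c →
      ∀ (s : ℕ), s ≤ padicValNat 3 W.tamagawaProduct →
        ∀ (n : ℕ) (d : KolyvaginHeegnerData Dt β ι n), Squarefree n →
          (∀ ℓ ∈ n.primeFactors, Zhang2014.IsKolyvaginPrime (W.conductorNorm ℤ) W K 3 ℓ ∧
            s ≤ Zhang2014.kolyvaginIndex W 3 ℓ) → PDiv d 3 s) :
    ∀ (W : WeierstrassCurve ℚ) [W.IsElliptic] [W.IsGloballyMinimal],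
      Summit.BirchSwinnertonDyer.Rank1Residual.ClassX11b W 3 →
      Literature.NumberTheory.EllipticCurves.Rank1Residual.Ram W 3 →
      Summit.BirchSwinnertonDyer.Rank1Residual.X11b.Three.ShapeAlpha W →
      Literature.NumberTheory.EllipticCurves.Rank1Residual.Typed.MissingUpperBoundAt W 3 :=
  fun W _ _ hX hram _ ↦ missingUpperBoundAt_three_of_classX11b_of_ram_of_jetchevDivisibility hGZ hKo hSk
    hGZK hmod hnf hHL hMaz hrec hD36 hMcU hJ W hX hram

/-- **Registered stub `stub_eulerGammaAtThree` (item 19109, shape γ∖α at split `3`), modulo the same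
binders** — signature verbatim; the split/shape hypotheses are not used. CONDITIONAL. [folklore] -/
theorem stub_eulerGammaAtThree_of_jetchevDivisibility
    (hGZ : ∀ (N : ℕ) [NeZero N] (W : WeierstrassCurve ℚ) (K : Type) [Field K] [NumberField K],
      gross_zagier N W K)
    (hKo : ∀ (N : ℕ) [NeZero N] (W : WeierstrassCurve ℚ) (K : Type) [Field K] [NumberField K],
      kolyvagin N W K)
    (hSk : Skinner2016.thmC_padicValRat_bsd_rank_zero)
    (hGZK : rank_eq_analyticRank_of_analyticRank_le_one) (hmod : hasEntireLFunction_rat)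
    (hnf : exists_isNewformOf) (hHL : HoffsteinLuo1997_exists_twist_L_one_ne_zero)
    (hMaz : mazur_not_dvd_maninConstant_of_odd)
    (hrec : ∀ (N : ℕ) [NeZero N] (W : WeierstrassCurve ℚ) (K : Type) [Field K] [NumberField K],
      heegnerPointOfConductor_one_galoisConj N W K)
    (hD36 : ∀ (N : ℕ) [NeZero N] (W : WeierstrassCurve ℚ) (K : Type) [Field K] [NumberField K],
      phi_heegnerTau_mem_singularModuliField N W K)
    (hMcU : McCallum1991_padicValNat_card_sha_primary_add_le_of_globalDivisibility)
    (hJ : ∀ (W : WeierstrassCurve ℚ) [W.IsElliptic] [W.IsGloballyMinimal] [NeZero (W.conductorNorm ℤ)]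
      (K : Type) [Field K] [NumberField K]
      (Dt : ModularParametrizationData W (W.conductorNorm ℤ)) (β : ℤ) (ι : K →+* ℂ),
      W.HasMultiplicativeReductionAtPrime 3 → Surj W 3 → Ram W 3 →
      IsImaginaryQuadratic K → SatisfiesHeegnerHypothesis (W.conductorNorm ℤ) K →
      NumberField.discr K ≠ -3 →
      (4 * (W.conductorNorm ℤ : ℤ)) ∣ β ^ 2 - NumberField.discr K → ¬ (3 : ℤ) ∣ Dt.c →
      ∀ (s : ℕ), s ≤ padicValNat 3 W.tamagawaProduct →
        ∀ (n : ℕ) (d : KolyvaginHeegnerData Dt β ι n), Squarefree n →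
          (∀ ℓ ∈ n.primeFactors, Zhang2014.IsKolyvaginPrime (W.conductorNorm ℤ) W K 3 ℓ ∧
            s ≤ Zhang2014.kolyvaginIndex W 3 ℓ) → PDiv d 3 s) :
    ∀ (W : WeierstrassCurve ℚ) [W.IsElliptic] [W.IsGloballyMinimal],
      Summit.BirchSwinnertonDyer.Rank1Residual.ClassX11b W 3 →
      Literature.NumberTheory.EllipticCurves.Rank1Residual.Ram W 3 →
      W.HasSplitMultiplicativeReductionAtPrime 3 →
      ¬ Summit.BirchSwinnertonDyer.Rank1Residual.X11b.Three.ShapeAlpha W →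
      Summit.BirchSwinnertonDyer.Rank1Residual.X11b.Three.ShapeGamma W →
      Literature.NumberTheory.EllipticCurves.Rank1Residual.Typed.MissingUpperBoundAt W 3 :=
  fun W _ _ hX hram _ _ _ ↦ missingUpperBoundAt_three_of_classX11b_of_ram_of_jetchevDivisibility hGZ hKo
    hSk hGZK hmod hnf hHL hMaz hrec hD36 hMcU hJ W hX hram

end Summit.BirchSwinnertonDyer.Rank1Residual.X11b.Three.Koly

end
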